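/-
Copyright (c) 2026 the pub-hodgecm-mathlib formalisation cell (harness21).  Prover seat hodgecm-mathlib-K2E3-p06 (g4), Track B «K2-LIT», engine E3, unit U4 «Keys»; deal (D61)
LINE LEAD of the open leaf (U4f-χ₁-ram-one), design D-I v2, plan step Z2A-3c (iii) + Z2A-5 «BRANCH A AT DEPTH ZERO: THE TYPE VECTOR AND THE CONTRADICTION» on `U(Φ₃)(L⁺_v)`;
2026-09-04.  KERNEL module: THEOREMS ONLY (no definition, no named fact, no `sorry`, no instance, no notation).
-/
import Summits.HodgeConjecture.HodgeConjecture.Theorems.K2E3BranchATypeLettersCM            -- ★-filed Z2A-3c (iii) letters (this seat): `exists_iwahoriDatum_K_zero_eq_Nbar_eq`, `theta_eq_tau_of_mem`, `theta_eq_one_of_map_mem`, `exists_mem_P_mul_of_mem`; brings (ii), (i), Z2A-3b, the frame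
import Summits.HodgeConjecture.HodgeConjecture.Theorems.K2E3BranchAContradiction             -- ★ Z2A-4 p858377 (this seat): `false_of_typeVector_of_integral_eq_zero`
import Summits.HodgeConjecture.HodgeConjecture.Theorems.K2E3TypeVectorOfSubrepFactored        -- ★ V2b p858197 (this seat): `exists_typeVector_of_mem_of_factored`
import Summits.HodgeConjecture.HodgeConjecture.Theorems.K2E3IwahoriDatumDilation              -- ★ Z2A-2 p858273 (this seat): `exists_dilate_typeReady`
import Summits.HodgeConjecture.HodgeConjecture.Theorems.K2E3IntertwiningKernelOfReducible     -- ★ V1 p857640 (this seat): `exists_section_apply_one_ne_zero_forall_intertwiningIntegral_eq_zero`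
import HarnessLib

/-!
# K2 ∕ E3 «EllipticInputs», unit U4 «Keys» — (U4f-χ₁-ram-one) steps Z2A-3c (iii) + Z2A-5: BRANCH A OF KEYS' THEOREM AT DEPTH ZERO
# «`χ₁` contracting, non-unitary, trivial on principal units, with `χ₁ ∘ N ≠ 1` on `𝒪ˣ` ⟹ `i(χ₁, 1)` is IRREDUCIBLE» on `U(Φ₃)(L⁺_v)`, `v` non-split (inert or ramified, any residue characteristic)
# [Keys1984 §3, §7 Thm (2); Casselman1995 §6.4; MoyPrasad1996 §3; Roche1998 §3–§4]

Cell hodgecm-mathlib (D-0151), FLOOR 0, Track B «K2-LIT», engine E3, crux item H413 = stmt-HodgeConjecture-24833 (route `HCCMUnconditional`, no route verbs); target BY NAME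
the OPEN leaf `…K2E3EllipticInputs.U4Keys.sig_K2E3KeysThmTwoContractingRamifiedCharOne` (U4Keys ED. 7), design D-I v2, plan step Z2A (Branch A), CM assembly.  Author K2E3-p06 (g4),
line lead (D61).  `--supports stmt-HodgeConjecture-24833 --as helper`; THEOREMS ONLY.  NOT THE PAYER (Branch A only, depth zero only; Branch B = Keys (b)–(d) is Z2–Z4).

THE POINT.  Design D-I «vanishing functional», Branch A, assembled on `G = U(Φ₃)(L⁺_v)` in the (G3)-EXPLICIT frame: suppose `i(χ) = i(χ₁, 1)` reducible.  ★ V1 gives a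
`G`-stable `V ∋ f`, `f(1) ≠ 0`, killed by `Λ_{w₀}`; §1 an Iwahori datum `𝓘` with `𝓘.K 0 = I` AND `𝓘.N̄ = eA⁻¹(N̄_w)` (★ p05's transport, clause kept); ★ Z2A-2 makes `f`
fixed by `I ∩ N̄` inside `V`; ★ V2b (letters: `hBC` from `𝓘.factorization 0`, §3; `hθmul` ★ Z2A-3b `theta_mul`; `hθH` §2 (`θ(p) = χ₁(torusEntry 0 (proj p)) = τ(p)·1` on `P ∩ I`,
`δ^{1∕2} = 1` on the compact `I`); `hθC` §2 (`θ = 1` on `eA⁻¹(N̄_w)`)) yields the `(I, θ)`-TYPE VECTOR `f′ ∈ V`, `f′(1) ≠ 0`; ★ Z2A-4 with the ★ letters (i) (`hw hN hdich hθ`) and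
(ii) (`b₀ hb₀H hne`, from `u ∈ 𝒪ˣ` with `χ₁(u σu) ≠ 1`) and `hΛ` from V1 gives `False`.
* **`false_of_reducible_of_normChar_ne_one`** (BRANCH A, depth zero, (G3)-frame + `w₀` + Haar measure as letters): reducible ⟹ `False` (letters from ★ `K2E3BranchATypeLettersCM`
  §1 datum with `N̄` clause, §2 `hθH`∕`hθC`, §3 `hBC`; ★ (i) `hw hN hdich hθ`; ★ (ii) `b₀ hb₀H hne`).
HONEST LABEL: HC_CM is proved only modulo the 7 printed citations (2 remaining named inputs: hLiu418 = stmt-HodgeConjecture-24832, h413 = stmt-HodgeConjecture-24833)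
until rung 0 closes; count-neutral — this file does NOT pay the leaf; no printed citation is discharged.

## References
* [Keys1984] D. Keys, Compositio Math. 51 (1984), §3, §7 Thm (2) (reducibility of unitary principal series of `SU(3)`∕`U(3)`: the group `W_χ`).
* [Casselman1995] W. Casselman, *Introduction to the theory of admissible representations of `p`-adic reductive groups* (1995), §6.4.
* [MoyPrasad1996] A. Moy, G. Prasad, Comment. Math. Helv. 71 (1996), §3 (depth-zero types).
* [Roche1998] A. Roche, Ann. Sci. ÉNS (4) 31 (1998), §3–§4.
* [BruhatTits1972] F. Bruhat, J. Tits, Publ. Math. IHÉS 41 (1972), (4.4.4).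
-/

set_option autoImplicit false
-- the mandated namespace has the single-problem summit's repeated segment (`HodgeConjecture.HodgeConjecture`)
set_option linter.dupNamespace false

noncomputable section

open NumberField IsDedekindDomain MeasureTheory
open scoped Matrix MatrixGroups WithZero Valued
open Literature.NumberTheory Literature.NumberTheory.Automorphic Literature.NumberTheory.Automorphic.UnitaryGroup
open Literature.NumberTheory.Rogawski1990

namespace Summit.HodgeConjecture.HodgeConjecture.Cruxes.H413.K2E3BranchAIrreducibleDepthZero

open Summit.HodgeConjecture.HodgeConjecture.Cruxes.H413
open Summit.HodgeConjecture.HodgeConjecture.Cruxes.H413.K2E3DepthZeroIwahoriCharacterCM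
open Summit.HodgeConjecture.HodgeConjecture.Cruxes.H413.K2E3BranchALettersCM
open Summit.HodgeConjecture.HodgeConjecture.Cruxes.H413.K2E3BranchATorusWitnessCM
open Summit.HodgeConjecture.HodgeConjecture.Cruxes.H413.K2E3BranchATypeLettersCM

variable (L : Type) [Field L] [NumberField L] [IsCMField L] (v : HeightOneSpectrum (𝓞 ↥(maximalRealSubfield L)))
  (w : PlacesOver L v) (hw : IsCMField.complexConj L • w.1 = w.1)
  (eA : Gqs L v ≃ₜ* ↥(unitaryGroupOfForm (galAdicCompletionMap (L := L) (IsCMField.complexConj L) hw) ((StdForm.antidiagonal 3).over (w.1.adicCompletion L))))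
  (heA : ∀ g : Gqs L v,
    ((eA g : ↥(unitaryGroupOfForm (galAdicCompletionMap (L := L) (IsCMField.complexConj L) hw) ((StdForm.antidiagonal 3).over (w.1.adicCompletion L)))) :
        GL (Fin 3) (w.1.adicCompletion L)) =
      ((localNonsplitEquiv (IsCMField.complexConj L) (qsForm L) (IsCMField.complexConj_ne_one L) w hw g :
        ↥(unitaryGroupOfForm (galAdicCompletionMap (L := L) (IsCMField.complexConj L) hw) (placeForm (qsForm L) w.1))) : GL (Fin 3) (w.1.adicCompletion L)))
  {ϖ : w.1.adicCompletion L} (hϖ : Valued.v ϖ = WithZero.exp (-1 : ℤ))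
  (g₁ : GL (Fin 3) (w.1.adicCompletion L)) (hg₁ : (g₁ : Matrix (Fin 3) (Fin 3) (w.1.adicCompletion L)) = Matrix.diagonal ![(1 : w.1.adicCompletion L), 1, ϖ])
  (K0 K1 I : Subgroup (Gqs L v))
  (hK0 : K0 = ((glInt 3 (w.1.adicCompletion L)).subgroupOf
    (unitaryGroupOfForm (galAdicCompletionMap (L := L) (IsCMField.complexConj L) hw) ((StdForm.antidiagonal 3).over (w.1.adicCompletion L)))).comap
      eA.toMulEquiv.toMonoidHom)
  (hK1 : K1 = (((glInt 3 (w.1.adicCompletion L)).map (MulAut.conj g₁).toMonoidHom).subgroupOf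
    (unitaryGroupOfForm (galAdicCompletionMap (L := L) (IsCMField.complexConj L) hw) ((StdForm.antidiagonal 3).over (w.1.adicCompletion L)))).comap
      eA.toMulEquiv.toMonoidHom)
  (hI : I = K0 ⊓ K1)


/-! ## §4 Branch A at depth zero: reducibility is impossible -/

open Classical in
include hw heA hϖ hg₁ hK0 hK1 hI in
set_option maxHeartbeats 16000000 in
set_option synthInstance.maxHeartbeats 400000 in
-- the `SmoothInd` carrier of `cmPrincipalSeries`, ★ V1∕V2b∕Z2A-2∕Z2A-4 instantiated on `U(Φ₃)(L⁺_v)` (class of ★ V1 §3)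
/-- **BRANCH A OF KEYS' THEOREM AT DEPTH ZERO (design D-I, assembled).**  `v` non-split, `χ₁` continuous, non-unitary, contracting, TRIVIAL ON PRINCIPAL UNITS (depth zero), and
`χ₁(u·σu) ≠ 1` for some unit `u` with `|u_{w′}| = 1` (Branch A: `χ₁ ∘ N ≠ 1` on `𝒪ˣ`, i.e. `w₀ ∉ W_χ`); `w₀` the element with matrix `Φ₃`, `μ` a Haar measure on `N(L⁺_v)`.  Then
`i(χ₁, 1)` is NOT reducible: ★ V1 (`V ∋ f`, `f(1) ≠ 0`, `Λ_{w₀}|_V = 0`) → §1 datum → ★ Z2A-2 (`I ∩ N̄` fixes a dilate of `f` in `V`) → ★ V2b with §2–§3 (`(I, θ)`-type vector `f′ ∈ V`,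
`f′(1) ≠ 0`) → ★ Z2A-4 with ★ letters (i), (ii) ⟹ `False`. [cite: Keys1984, §3, §7 Thm (2)] [cite: Casselman1995, §6.4] [cite: MoyPrasad1996, §3] [cite: Roche1998, §3–§4] -/
theorem false_of_reducible_of_normChar_ne_one
    (hns : ∀ w' : PlacesOver L v, IsCMField.complexConj L • w'.1 = w'.1)
    (χ₁ : (LocalRing L v)ˣ →* ℂˣ) (h₁ : Continuous fun x => ((χ₁ x : ℂˣ) : ℂ)) (hnu : ∃ x, ‖((χ₁ x : ℂˣ) : ℂ)‖ ≠ 1)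
    (hcontr : ∀ x : (LocalRing L v)ˣ, unitModulusChar (LocalRing L v) x < 1 → ‖((χ₁ x : ℂˣ) : ℂ)‖ < 1)
    (hdepth : ∀ u : (LocalRing L v)ˣ, (∀ w' : PlacesOver L v, Valued.v (((u : LocalRing L v) w') - 1) < 1) → χ₁ u = 1)
    (u : (LocalRing L v)ˣ) (hu : ∀ w' : PlacesOver L v, Valued.v ((u : LocalRing L v) w') = 1)
    (hA : χ₁ (u * Units.map (conjLocal L (IsCMField.complexConj L) v : LocalRing L v →* LocalRing L v) u) ≠ 1)
    (w₀ : ↥(unitaryGroupOfForm (conjLocal L (IsCMField.complexConj L) v) (cmLocalForm L 3 v))) (hw₀ : Units.val (w₀ : GL (Fin 3) (LocalRing L v)) = cmLocalForm L 3 v)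
    [MeasurableSpace ↥(cmBorelTriple L 3 v).N] [BorelSpace ↥(cmBorelTriple L 3 v).N] (μ : Measure ↥(cmBorelTriple L 3 v).N) [μ.IsHaarMeasure]
    (hred : ∃ N : Subrepresentation (cmPrincipalSeries L 3 v (cmTorusCharPair L v χ₁ 1)), N ≠ ⊥ ∧ N ≠ ⊤) : False := by
  haveI := locallyCompactSpace_cmBorelU L 3 v
  -- ★ V1: a `G`-stable `V ∋ f`, `f(1) ≠ 0`, killed by the intertwining functional `Λ_{w₀}`
  have h₂ : Continuous fun x : ↥(normOneUnits (conjLocal L (IsCMField.complexConj L) v)) =>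
      (((1 : ↥(normOneUnits (conjLocal L (IsCMField.complexConj L) v)) →* ℂˣ) x : ℂˣ) : ℂ) := by
    simp only [MonoidHom.one_apply]; exact continuous_const
  obtain ⟨V, f, hfV, hf1, hΛ⟩ :=
    K2E3IntertwiningKernelOfReducible.exists_section_apply_one_ne_zero_forall_intertwiningIntegral_eq_zero L v hns χ₁ 1 h₁ h₂ hnu hcontr hred w₀ hw₀ μ
  -- §1: the Iwahori datum with `K 0 = I`, `N̄ = eA⁻¹(N̄_w)`
  obtain ⟨𝓘, hK0I, hNbar⟩ := exists_iwahoriDatum_K_zero_eq_Nbar_eq L v w hw eA heA hϖ g₁ hg₁ K0 K1 I hK0 hK1 hI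
  subst hK0I
  -- ★ Z2A-2 at level `0`: a dilate of `f` inside `V`, non-zero at `1`, fixed by `I ∩ N̄`
  obtain ⟨i, hf₁V, hf₁1, hf₁fix⟩ := K2E3IwahoriDatumDilation.exists_dilate_typeReady (cmBorelTriple L 3 v).P _ (cmBorelTriple L 3 v) 𝓘
    (cmBorelTriple L 3 v).M_le V f hfV hf1 0
  -- ★ V2b: the `(I, θ)`-type vector
  obtain ⟨f', hf'V, hf'1, heig⟩ := K2E3TypeVectorOfSubrepFactored.exists_typeVector_of_mem_of_factored (cmBorelTriple L 3 v).P _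
    (𝓘.K 0) (𝓘.K 0 ⊓ 𝓘.Nbar) (𝓘.isCompact_K 0) (fun b hb => exists_mem_P_mul_of_mem _ 𝓘 0 hb)
    (fun g : ↥(unitaryGroupOfForm (conjLocal L (IsCMField.complexConj L) v) (cmLocalForm L 3 v)) => if h : IsUnit (((g : GL (Fin 3) (LocalRing L v)) : Matrix (Fin 3) (Fin 3) (LocalRing L v)) 0 0) then ((χ₁ h.unit : ℂˣ) : ℂ) else 0)
    (fun x hx y hy => theta_mul L v w hw eA heA hϖ g₁ hg₁ K0 K1 (𝓘.K 0) hK0 hK1 hI χ₁ hdepth hx hy)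
    (fun p hp hpI => theta_eq_tau_of_mem L v w hw eA heA hϖ g₁ hg₁ K0 K1 (𝓘.K 0) hK0 hK1 hI χ₁ p hp hpI)
    (fun c hc _ => theta_eq_one_of_map_mem L v w hw eA heA χ₁ (by
      have h := (Subgroup.mem_inf.1 hc).2
      rw [hNbar] at h
      exact h))
    V _ hf₁V hf₁1 (fun c hc _ => hf₁fix c hc)
  -- ★ letters (ii): the disagreeing torus element
  obtain ⟨b₀, hb₀P, hb₀I, hne⟩ := exists_torusWitness L v w hw eA heA hϖ g₁ hg₁ K0 K1 (𝓘.K 0) hK0 hK1 hI w₀ hw₀ χ₁ u hu hA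
  -- ★ Z2A-4 with ★ letters (i)
  exact K2E3BranchAContradiction.false_of_typeVector_of_integral_eq_zero (cmBorelTriple L 3 v).P _ (cmBorelTriple L 3 v).N (𝓘.K 0) μ
    (LineRing.isClosed_unipotentU (conjLocal L (IsCMField.complexConj L) v) (cmLocalForm L 3 v)) (𝓘.isOpen_K 0) (𝓘.isCompact_K 0)
    w₀ (w₀_mul_w₀_mem L v w hw eA heA (𝓘.K 0) w₀ hw₀) _ f' heig hf'1 b₀ hb₀I hb₀P hne
    (fun n => dichotomy_conj L v w hw eA heA hϖ g₁ hg₁ K0 K1 (𝓘.K 0) hK0 hK1 hI (cmBorelTriple L 3 v) rfl w₀ hw₀ n.2)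
    (fun n _ => theta_conj_eq_one L v w hw eA heA (cmBorelTriple L 3 v) rfl w₀ hw₀ χ₁ n.2)
    (hΛ f' hf'V w₀)

end Summit.HodgeConjecture.HodgeConjecture.Cruxes.H413.K2E3BranchAIrreducibleDepthZero

end
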